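import Mathlib
import HarnessLib
import Summits.ValiantsHypothesis.ValiantsHypothesis.Theorems.LacunarySymmetroidMatrixDescartesProductPlusOneCloudDefs
import Summits.ValiantsHypothesis.ValiantsHypothesis.Theorems.LacunarySymmetroidMatrixDescartesCensusTwoRowBoxLeaf

/-!
# LINE (A) `product_plus_one` (crux `MatrixDescartes`, stmt-ValiantsHypothesis-18050) — brick W1: THE W∘W IDENTITY for trinomials,
# its TOWER FORM `ψ₁ψ₃ − ψ₂² = 2ψ₁³ + (pq(q−p))²·ABC·x^{p+q}·u³`, and the two SIGN PACKS (log-convex background / log-concave bump)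

`--supports stmt-ValiantsHypothesis-18050 --as helper` (val-port-4 g4; brick W1 named by the pen val-idea-25 g4, 2026-08-29T05:38:08Z,
memo §21 / scratch `ideators/val-idea-25/staged/scratch21-ww-identity-onebump.lean` de70de752dacfceb; desk RULING #520 (A); critics crit-6 g4 /
crit-1 g5).  No definition, no named fact, no instance, no notation.

With `W(g) = g·θ(θg) − (θg)²`, `θ = X·d/dX` (spelled inline exactly as in ✓ `logWronskian_mul`):

* (i) POLYNOMIAL FORM (via ✓ `Census.X_mul_derivative_C_mul_X_pow`, `θ(aX^e) = (a·e)X^e`, cited by name).  `thetaW_trinomial` — the log-Wronskian of a trinomial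
  `g = aX^{e₀} + bX^{e₁} + cX^{e₂}` is the trinomial of pair products `(e₁−e₀)²ab·X^{e₀+e₁} + (e₂−e₀)²ac·X^{e₀+e₂} + (e₂−e₁)²bc·X^{e₁+e₂}`
  (all exponents, equal ones included) — and ★ `thetaW_thetaW_trinomial`, THE W∘W IDENTITY
  `W(W(g)) = Δ²·(abc)·X^{e₀+e₁+e₂}·g`, `Δ = (e₁−e₀)(e₂−e₀)(e₂−e₁)` (= `WWIdentity` of the pen's scratch, verbatim statement).
* (ii) TOWER FORM in the letters of ✓ `…CloudDefs` (row `A − Bx^p − Cx^q`, `p = e₁+1`, `q = e₁+e₂+2`, `q − p = e₂+1`, `u = rowU`,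
  `ψ_k = rowPsi_k`): ★ `rowPsi_det13_eq`: `ψ₁·ψ₃ − ψ₂² = 2·ψ₁³ + (p·q·(q−p))²·A·B·C·x^{p+q}·u³` (`field_simp; ring`; sanity: `C = 0` gives
  the pure-pole certificate `2ψ₁³`).
* (iii) SIGN PACKS, immediate from (ii): `rowPsi_logConvex_of` (`0 < ψ₁`, `0 ≤ ABC·x^{p+q}·u³` ⇒ `ψ₂² < ψ₁ψ₃` — BACKGROUND rows: binomial
  risers on either side of their root, unswitched incoherent rows before their pole, switched coherent rows past their pole) and
  ★ `rowPsi_logConcave_of` (`ψ₁ < 0`, `ABC·x^{p+q}·u³ ≤ 0` ⇒ `ψ₁ψ₃ − ψ₂² < 0` — BUMP rows: binomial knees, the tail-knee phase of a switched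
  incoherent row, the knee phase of an unswitched coherent row).  (`A − Bx^p − Cx^q ≠ 0` follows from `ψ₁ ≠ 0`, so it is not a hypothesis.)

WHY (pen, memo §21): W1 is the one-line algebra behind every log-convexity / log-concavity certificate of the W-cells:
`(log|F_g|)″ = −2F_g + Δ²abc·x^{Σe}·g/W(g)²` for the row field `F_g = W(g)/g²`.
HONEST LABEL: an algebraic identity and two sign corollaries — instruments of the real-rooted / W-currency side of LINE (A); no stub closes
(`stub_eulerBoundK3` / `stub_oneChangeFloorK3` / `stub_classRowK3` / `stub_polyLaw`, `WronskianBudgetK3` OPEN); 18050 `MatrixDescartes` OPEN;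
0 distance until a stub closes; VP ≠ VNP is NOT proved here or anywhere in this tree. [folklore]
-/

noncomputable section

-- single-conjunct layout: Sub = Summit, duplicated namespace component intended
set_option linter.dupNamespace false

namespace Summit.ValiantsHypothesis.ValiantsHypothesis.Theorems.LacunarySymmetroidMatrixDescartes

namespace ProductPlusOne

open Polynomial

/-! ### (i) The polynomial form: `W` of a trinomial, and `W ∘ W` -/

/-- **`W` OF A TRINOMIAL** (E6-W of the pen's memo §21): for `g = aX^{e₀} + bX^{e₁} + cX^{e₂}`,
`W(g) = g·θ(θg) − (θg)² = (e₁−e₀)²ab·X^{e₀+e₁} + (e₂−e₀)²ac·X^{e₀+e₂} + (e₂−e₁)²bc·X^{e₁+e₂}` — the trinomial of pair products (valid for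
all exponents, equal ones included). [folklore] -/
theorem thetaW_trinomial (a b c : ℝ) (e₀ e₁ e₂ : ℕ) :
    (C a * X ^ e₀ + C b * X ^ e₁ + C c * X ^ e₂ : ℝ[X]) *
          (X * derivative (X * derivative (C a * X ^ e₀ + C b * X ^ e₁ + C c * X ^ e₂ : ℝ[X])))
        - (X * derivative (C a * X ^ e₀ + C b * X ^ e₁ + C c * X ^ e₂ : ℝ[X])) ^ 2
      = C (((e₁ : ℝ) - e₀) ^ 2 * (a * b)) * X ^ (e₀ + e₁) + C (((e₂ : ℝ) - e₀) ^ 2 * (a * c)) * X ^ (e₀ + e₂) +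
        C (((e₂ : ℝ) - e₁) ^ 2 * (b * c)) * X ^ (e₁ + e₂) := by
  have hθ : (X : ℝ[X]) * derivative (C a * X ^ e₀ + C b * X ^ e₁ + C c * X ^ e₂ : ℝ[X])
      = C (a * (e₀ : ℝ)) * X ^ e₀ + C (b * (e₁ : ℝ)) * X ^ e₁ + C (c * (e₂ : ℝ)) * X ^ e₂ := by
    rw [derivative_add, derivative_add, mul_add, mul_add, Census.X_mul_derivative_C_mul_X_pow,
      Census.X_mul_derivative_C_mul_X_pow, Census.X_mul_derivative_C_mul_X_pow]
  have hθθ : (X : ℝ[X]) * derivative (X * derivative (C a * X ^ e₀ + C b * X ^ e₁ + C c * X ^ e₂ : ℝ[X]))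
      = C (a * (e₀ : ℝ) * (e₀ : ℝ)) * X ^ e₀ + C (b * (e₁ : ℝ) * (e₁ : ℝ)) * X ^ e₁ + C (c * (e₂ : ℝ) * (e₂ : ℝ)) * X ^ e₂ := by
    rw [hθ, derivative_add, derivative_add, mul_add, mul_add, Census.X_mul_derivative_C_mul_X_pow,
      Census.X_mul_derivative_C_mul_X_pow, Census.X_mul_derivative_C_mul_X_pow]
  rw [hθθ, hθ]
  simp only [map_mul, map_pow, map_sub, map_natCast]
  ring

/-- ★ **THE W∘W IDENTITY** (E6-I of the pen's memo §21; statement = `WWIdentity` of the pen's scratch21, verbatim): for every trinomial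
`g = aX^{e₀} + bX^{e₁} + cX^{e₂}`, `W(W(g)) = Δ²·(abc)·X^{e₀+e₁+e₂}·g` with `Δ = (e₁−e₀)(e₂−e₀)(e₂−e₁)`.  Consequence used by the W-cells:
`(log |F_g|)″ = −2F_g + Δ²abc·x^{Σe}·g / W(g)²` for the row field `F_g = W(g)/g²`. [folklore] -/
theorem thetaW_thetaW_trinomial (a b c : ℝ) (e₀ e₁ e₂ : ℕ) :
    let g : ℝ[X] := C a * X ^ e₀ + C b * X ^ e₁ + C c * X ^ e₂
    let Wg : ℝ[X] := g * (X * derivative (X * derivative g)) - (X * derivative g) ^ 2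
    Wg * (X * derivative (X * derivative Wg)) - (X * derivative Wg) ^ 2
      = C ((((e₁ : ℝ) - e₀) * ((e₂ : ℝ) - e₀) * ((e₂ : ℝ) - e₁)) ^ 2 * (a * b * c)) * X ^ (e₀ + e₁ + e₂) *
          (C a * X ^ e₀ + C b * X ^ e₁ + C c * X ^ e₂) := by
  intro g Wg
  have hW : Wg = C (((e₁ : ℝ) - e₀) ^ 2 * (a * b)) * X ^ (e₀ + e₁) + C (((e₂ : ℝ) - e₀) ^ 2 * (a * c)) * X ^ (e₀ + e₂) +
      C (((e₂ : ℝ) - e₁) ^ 2 * (b * c)) * X ^ (e₁ + e₂) := thetaW_trinomial a b c e₀ e₁ e₂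
  rw [hW, thetaW_trinomial]
  simp only [Nat.cast_add, map_mul, map_pow, map_sub, map_add, map_natCast]
  ring

/-! ### (ii) The tower form in the letters of `…CloudDefs` -/

variable (e₁ e₂ : ℕ) (A B C : ℝ)

/-- If the row value `A − Bx^p − Cx^q` vanishes then (Lean's `0⁻¹ = 0`) `ψ₁ = 0`; so `ψ₁ ≠ 0` forces `A − Bx^p − Cx^q ≠ 0`. -/
theorem row_ne_zero_of_rowPsi1_ne_zero {x : ℝ} (h : rowPsi1 e₁ e₂ A B C x ≠ 0) :
    A - B * x ^ (e₁ + 1) - C * x ^ (e₁ + e₂ + 2) ≠ 0 := by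
  intro hF
  apply h
  simp [rowPsi1, rowU, hF]

/-- ★ **TOWER FORM OF THE W∘W IDENTITY** (row `A − Bx^p − Cx^q`, `p = e₁+1`, `q = e₁+e₂+2`, so `q − p = e₂+1`; `u = rowU`, `ψ_k = rowPsi_k`):
`ψ₁·ψ₃ − ψ₂² = 2·ψ₁³ + (p·q·(q−p))²·A·B·C·x^{p+q}·u³` = ✓ `rowPsi_slope_identity` (`…SlopeConvexity`) after ✓ `rowH0_mul_rowU_add_one`, in the
`A·B·C·x^{p+q}·u³` normal form (pen val-idea-25 g4, 05:49:33Z).  SANITY: `C = 0` (a binomial, pure pole) gives `ψ₁ψ₃ − ψ₂² = 2ψ₁³`, the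
certificate behind `switchedPole_signs`. [folklore] -/
theorem rowPsi_det13_eq {x : ℝ} (hF : A - B * x ^ (e₁ + 1) - C * x ^ (e₁ + e₂ + 2) ≠ 0) :
    rowPsi1 e₁ e₂ A B C x * rowPsi3 e₁ e₂ A B C x - rowPsi2 e₁ e₂ A B C x ^ 2
      = 2 * rowPsi1 e₁ e₂ A B C x ^ 3 +
        (((e₁ : ℝ) + 1) * ((e₁ : ℝ) + e₂ + 2) * ((e₂ : ℝ) + 1)) ^ 2 * (A * B * C) * x ^ (e₁ + 1 + (e₁ + e₂ + 2)) *
          rowU e₁ e₂ A B C x ^ 3 := by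
  unfold rowPsi1 rowPsi2 rowPsi3 rowH rowU
  rw [pow_add x (e₁ + 1) (e₁ + e₂ + 2)]
  field_simp
  ring

/-! ### (iii) The two sign packs -/

/-- **BACKGROUND SIGN PACK (log-convex):** `0 < ψ₁` and `0 ≤ A·B·C·x^{p+q}·u³` give `ψ₂² < ψ₁·ψ₃` — covers binomial risers on either side of
their root (`ABC = 0`), unswitched incoherent rows before their pole and switched coherent rows past their pole. [this file's corollary] -/
theorem rowPsi_logConvex_of {x : ℝ} (h1 : 0 < rowPsi1 e₁ e₂ A B C x)
    (hc : 0 ≤ A * B * C * x ^ (e₁ + 1 + (e₁ + e₂ + 2)) * rowU e₁ e₂ A B C x ^ 3) :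
    rowPsi2 e₁ e₂ A B C x ^ 2 < rowPsi1 e₁ e₂ A B C x * rowPsi3 e₁ e₂ A B C x := by
  have h := rowPsi_det13_eq e₁ e₂ A B C (row_ne_zero_of_rowPsi1_ne_zero e₁ e₂ A B C h1.ne')
  have h3 : 0 < rowPsi1 e₁ e₂ A B C x ^ 3 := pow_pos h1 3
  nlinarith [sq_nonneg (((e₁ : ℝ) + 1) * ((e₁ : ℝ) + e₂ + 2) * ((e₂ : ℝ) + 1)),
    mul_nonneg (sq_nonneg (((e₁ : ℝ) + 1) * ((e₁ : ℝ) + e₂ + 2) * ((e₂ : ℝ) + 1))) hc]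

/-- ★ **BUMP SIGN PACK (log-concave):** `ψ₁ < 0` and `A·B·C·x^{p+q}·u³ ≤ 0` give `ψ₁·ψ₃ − ψ₂² < 0` — covers binomial knees (`ABC = 0`), the
tail-knee phase of a switched incoherent row and the knee phase of an unswitched coherent row; equivalent to ✓ `slope_logConcave_of_sign`
(`…SlopeKnee` l.172; hypothesis with `u` instead of `u³`). [this file's corollary] -/
theorem rowPsi_logConcave_of {x : ℝ} (h1 : rowPsi1 e₁ e₂ A B C x < 0)
    (hc : A * B * C * x ^ (e₁ + 1 + (e₁ + e₂ + 2)) * rowU e₁ e₂ A B C x ^ 3 ≤ 0) :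
    rowPsi1 e₁ e₂ A B C x * rowPsi3 e₁ e₂ A B C x - rowPsi2 e₁ e₂ A B C x ^ 2 < 0 := by
  have h := rowPsi_det13_eq e₁ e₂ A B C (row_ne_zero_of_rowPsi1_ne_zero e₁ e₂ A B C h1.ne)
  have h3 : rowPsi1 e₁ e₂ A B C x ^ 3 < 0 := by
    have : 0 < (-rowPsi1 e₁ e₂ A B C x) ^ 3 := pow_pos (neg_pos.mpr h1) 3
    nlinarith [this]
  nlinarith [sq_nonneg (((e₁ : ℝ) + 1) * ((e₁ : ℝ) + e₂ + 2) * ((e₂ : ℝ) + 1)),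
    mul_nonpos_iff.mpr (Or.inl ⟨sq_nonneg (((e₁ : ℝ) + 1) * ((e₁ : ℝ) + e₂ + 2) * ((e₂ : ℝ) + 1)), hc⟩)]

end ProductPlusOne

end Summit.ValiantsHypothesis.ValiantsHypothesis.Theorems.LacunarySymmetroidMatrixDescartes

end
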